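import Summits.Ventures.HodgeRepro.CongruenceHermitian
import Summits.Ventures.HodgeRepro.BallGenInvariance
import Summits.Ventures.HodgeRepro.RealApproxUnitary

/-!
# Lemma W for every `p` with its finite cover, on the rational points of any Hermitian form (seat p5)

Blind re-derivation cell `pub-hodge-repro`, seat `p5`.  Built on typer-2's `BallGenLemmaW.lemmaW_iter`
(Lemma W iterated, any dense `Δ ≤ U(p,1)`), `RealApproxUnitary.dense_ratPointsOf` (real approximation PROVED:
the rational points `ratPointsOf φ₀ H_K P hP` of the unitary group of ANY Hermitian form `H_K` of signature
`(p,1)` over a CM field are dense in `U(p,1)`), p5's `BallGenInvariance` (the top form of `p` translated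
invariant fields is invariant under `⨅ᵢ γᵢ⁻¹ Γ γᵢ`) and p5's `CongruenceHermitian` (finite index of
`Γ′ ⊓ γ⁻¹ Γ′ γ` inside `ratPointsOf` for every rational `γ`).  Mathlib otherwise.

* `isFiniteRelIndex_inf_iInf` — finitely many subgroups of finite relative index in `Γ` intersect to one;
* `isFiniteRelIndex_inf_iInf_conjSubG_ratPointsOf` — A4's iterated `Γ″ = Γ′ ⊓ ⨅ᵢ γᵢ⁻¹ Γ′ γᵢ` has finite index
  in `Γ′` for finitely many rational `γᵢ`;
* **`lemmaW_iter_finiteCover_ratPointsOf`** — ROUTE.md A4 «Iteration (R5)» on the rational points of an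
  arbitrary form: for `Γ(M) ≤ Γ′ ≤ U(H_K)(𝓞_K)` (`M ≠ 0`), transported to `U(p,1)`, and `p` continuous
  `Γ′`-invariant fields `ω₁ … ω_p` each non-zero somewhere, there are rational `γ₁ … γ_p` with
  `γ₁^*ω₁ ∧ ⋯ ∧ γ_p^*ω_p ≢ 0`, invariant under `Γ″`, and `Γ″` of finite index in `Γ′`.

Nothing here says anything about the status of the Hodge conjecture for CM abelian varieties.
-/

set_option autoImplicit false

noncomputable section

namespace Summit.Ventures.HodgeRepro

namespace CongHerm

open Matrix
open NumberField
open HodgeRepro.BallGen (Idx GLp U Ball unitaryGroupOf ratPointsOf pullback lemmaW_iter)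
open HodgeRepro.BallGen.RealApprox (dense_ratPointsOf)
open HodgeRepro.BallGen.Inv (IsInvariant IsInvariantTop topForm conjSub exists_invariantTop_topForm_ne_zero)
open CongGen

/-! ### Finite intersections of finite-index subgroups -/

section iInf

variable {G : Type} [Group G]

/-- `Inv.conjSub` (p5's `BallGenInvariance`) and `CongGen.conjSubG` are the same subgroup. -/
theorem conjSub_eq_conjSubG {p : ℕ} (g : U p) (Γ : Subgroup (U p)) : conjSub g Γ = conjSubG g Γ := rfl

/-- Finitely many subgroups `Hᵢ` with `Γ ⊓ Hᵢ` of finite index in `Γ` give `Γ ⊓ ⨅ᵢ Hᵢ` of finite index in `Γ`. -/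
theorem isFiniteRelIndex_inf_iInf {ι : Type} [Finite ι] {Γ : Subgroup G} {H : ι → Subgroup G}
    (h : ∀ i, (Γ ⊓ H i).IsFiniteRelIndex Γ) : (Γ ⊓ ⨅ i, H i).IsFiniteRelIndex Γ := by
  rw [Subgroup.isFiniteRelIndex_iff_finiteIndex, Subgroup.inf_subgroupOf_left]
  have h' : ∀ i, ((H i).subgroupOf Γ).FiniteIndex := fun i => by
    have := (Subgroup.isFiniteRelIndex_iff_finiteIndex.mp (h i))
    rwa [Subgroup.inf_subgroupOf_left] at this
  rw [Subgroup.subgroupOf, Subgroup.comap_iInf]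
  exact Subgroup.finiteIndex_iInf h'

end iInf

/-! ### The iterated finite cover on the rational points of an arbitrary form -/

variable {p : ℕ} {K : Type} [Field K] [NumberField K] [IsCMField K]
variable (HK : Matrix (Idx p) (Idx p) K) (φ₀ : K →+* ℂ) (P : GLp p)
  (hP : (P : Matrix (Idx p) (Idx p) ℂ)ᴴ * HK.map φ₀ * (P : Matrix (Idx p) (Idx p) ℂ) = HodgeRepro.BallGen.J p)

/-- **A4's iterated `Γ″`, inside `U(p,1)`.**  For `Γ(M) ≤ Γ′ ≤ U(H_K)(𝓞_K)` (`M ≠ 0`) transported to `U(p,1)`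
and finitely many rational `γᵢ ∈ ratPointsOf`, `Γ′ ⊓ ⨅ᵢ γᵢ⁻¹ Γ′ γᵢ` has finite index in `Γ′`. -/
theorem isFiniteRelIndex_inf_iInf_conjSubG_ratPointsOf {Γ' : Subgroup (unitaryGroupOf HK)}
    (hΓ : Γ' ≤ arithU HK) {M : 𝓞 K} (hM0 : M ≠ 0) (hM : congrU HK M ≤ Γ') {ι : Type} [Finite ι]
    (γ : ι → U p) (hγ : ∀ i, γ i ∈ ratPointsOf φ₀ HK P hP) :
    (Γ'.map (toUp HK φ₀ P hP) ⊓ ⨅ i, conjSubG (γ i) (Γ'.map (toUp HK φ₀ P hP))).IsFiniteRelIndex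
      (Γ'.map (toUp HK φ₀ P hP)) := by
  refine isFiniteRelIndex_inf_iInf fun i => ?_
  obtain ⟨g, hg⟩ := hγ i
  rw [← hg]
  exact isFiniteRelIndex_inf_conjSubG_ratPointsOf HK φ₀ P hP hΓ hM0 hM g

/-- **Lemma W for every `p` with its finite cover, on the rational points of an arbitrary Hermitian form of
signature `(p,1)` over a CM field (ROUTE.md A4, «Iteration (R5)»).**  Let `Γ(M) ≤ Γ′ ≤ U(H_K)(𝓞_K)`, `M ≠ 0`,
be transported to `U(p,1)` by `toUp`, and let `ω₁, …, ω_p` be continuous cotangent fields on `𝔹^p`, each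
non-zero somewhere and invariant under the transported `Γ′`.  Then there are rational `γ₁, …, γ_p ∈ ratPointsOf`
such that the `(p,0)`-form `γ₁^*ω₁ ∧ ⋯ ∧ γ_p^*ω_p` is not identically zero, is invariant under
`Γ″ = Γ′ ⊓ ⨅ᵢ γᵢ⁻¹ Γ′ γᵢ`, and `Γ″` has finite index in `Γ′`. -/
theorem lemmaW_iter_finiteCover_ratPointsOf {Γ' : Subgroup (unitaryGroupOf HK)} (hΓ : Γ' ≤ arithU HK)
    {M : 𝓞 K} (hM0 : M ≠ 0) (hM : congrU HK M ≤ Γ') (ω : Fin p → Ball p → Fin p → ℂ)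
    (hω : ∀ j, Continuous (ω j)) (hω0 : ∀ j, ∃ w, ω j w ≠ 0)
    (hωΓ : ∀ j, IsInvariant (Γ'.map (toUp HK φ₀ P hP)) (ω j)) :
    ∃ γ : Fin p → U p, (∀ j, γ j ∈ ratPointsOf φ₀ HK P hP) ∧
      (topForm fun j => pullback (γ j) (ω j)) ≠ 0 ∧
      IsInvariantTop (Γ'.map (toUp HK φ₀ P hP) ⊓ ⨅ j, conjSubG (γ j) (Γ'.map (toUp HK φ₀ P hP)))
        (topForm fun j => pullback (γ j) (ω j)) ∧
      (Γ'.map (toUp HK φ₀ P hP) ⊓ ⨅ j, conjSubG (γ j) (Γ'.map (toUp HK φ₀ P hP))).IsFiniteRelIndex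
        (Γ'.map (toUp HK φ₀ P hP)) := by
  obtain ⟨γ, hγ, z, hz⟩ := lemmaW_iter (dense_ratPointsOf φ₀ HK P hP) p le_rfl ω hω hω0
  obtain ⟨hinv, hne⟩ := exists_invariantTop_topForm_ne_zero hωΓ γ hz
  refine ⟨γ, hγ, hne, hinv.mono inf_le_right, ?_⟩
  exact isFiniteRelIndex_inf_iInf_conjSubG_ratPointsOf HK φ₀ P hP hΓ hM0 hM γ hγ

end CongHerm

end Summit.Ventures.HodgeRepro

end
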